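import Summits.CriticalPhenomena.PercolationContinuityZ3.Theorems.PercAnnulusCrossingNoiseInfluence
import Mathlib.Analysis.SpecialFunctions.Integrals.Basic
import HarnessLib

/-!
# RSW3 lane (lead, gen 23): ANATOMY OF THE HARRIS SLACK, I — the covariance of two functions on the p-biased cube is the
# noise integral of their joint pivotality; Harris–FKG with an exact remainder; decorrelation by overlapping influences

builds on p205010 (kernel theorem, internal audit signed; external expert review pending) — NOT used in this file (abstract).

Cell `prim-rsw3` (LANE 3), lead seat, gen 23.  Support file (`--supports stmt-CriticalPhenomena-4575`); no definitions, no named facts,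
no sorries.  Setting of gens 20–22 (`…NoiseFourier`, `…NoiseStability`, `…NoiseInfluence`): finite product cube `ι → Bool`, biases
`p ∈ [0,1]^ι` (degenerate coordinates allowed), product weight `wt p`, a character system `r` with (H1)/(H2), coefficients
`f̂(S) = Σ_x wt(x) f(x) χ_S(x)`, the `ε`-noised copy `ω^ε = (y on {m = 1}, x elsewhere)` (`y ~ wt p`, mask `m ~ wt ε̄`), and the discrete
derivative `D_i f(x) = f(x^{i→1}) − f(x^{i→0})` (for a monotone 0/1-valued `f`: the indicator that `i` is pivotal).  Proved, every `p ∈ [0,1]^ι`: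

* §1 `noise_cross_correlation_eq_sum_coeff` — the MIXED spectral formula `E[f(ω)·g(ω^ε)] = Σ_S (1−ε)^{|S|} f̂(S)ĝ(S)`;
  `coeff_insert_eq_bias_mul` — `f̂(S ∪ {i}) = p_i r_i(1)·(D_i f)^(S)` (`i ∉ S`), with `(p_i r_i(1))² = p_i(1−p_i)` (`sq_bias_mul_char_eq`);
  `coeff_deriv_eq_zero_of_mem` — `(D_i f)^(S) = 0` for `i ∈ S`.
* §2 **`bias_mul_deriv_noise_eq_sum_coeff`** — THE JOINT-PIVOTAL SPECTRAL FORMULA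
  `p_i(1−p_i)·E[D_i f(ω)·D_i g(ω^ε)] = Σ_{S ∋ i} (1−ε)^{|S|−1} f̂(S)ĝ(S)`, and summed over `i`:
  **`sum_bias_mul_deriv_noise_eq`** — `Σ_i p_i(1−p_i)·E[D_i f(ω)·D_i g(ω^ε)] = Σ_S |S|(1−ε)^{|S|−1} f̂(S)ĝ(S) = −d/dε E[f(ω)g(ω^ε)]`.
* §3 **`noise_cross_correlation_sub_eq_integral`** — THE HARRIS SLACK AS A NOISE INTEGRAL (no characters in the statement):
  `E[f(ω)g(ω^a)] − E[f(ω)g(ω^b)] = ∫_a^b Σ_i p_i(1−p_i)·E[D_i f(ω)·D_i g(ω^ε)] dε`, in particular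
  **`cov_eq_integral`** — `E[fg] − E[f]E[g] = ∫_0^1 Σ_i p_i(1−p_i)·E[D_i f(ω)·D_i g(ω^ε)] dε`: the covariance is the average over the
  noise level of the `p(1−p)`-weighted number of coordinates pivotal for `f` in `ω` AND for `g` in the `ε`-noised copy.
* Part II (`…HarrisSlackBounds`): Harris–FKG with this remainder, monotonicity of `ε ↦ E[f(ω)g(ω^ε)]` for monotone pairs, and the
  decorrelation bound `|E[fg] − E[f]E[g]| ≤ Σ_i p_i(1−p_i)·√E[(D_i f)²]·√E[(D_i g)²]` for arbitrary `f, g`.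

References: T. E. Harris, Proc. Camb. Phil. Soc. 56 (1960) 13–20 (Harris' lemma); C. Fortuin, P. Kasteleyn, J. Ginibre, Comm. Math. Phys. 22
(1971); M. Talagrand, *How much are increasing sets positively correlated?*, Combinatorica 16 (1996) 243–258 (the interpolation
`d/dρ ⟨f, T_ρ g⟩ = Σ_i ⟨∂_i f, T_ρ ∂_i g⟩` behind Thm 1.1); N. Keller, E. Mossel, A. Sen, *Geometric influences II*, Ann. Inst. H. Poincaré 50
(2014) §3 (the same semigroup formula for product measures); R. O'Donnell, *Analysis of Boolean Functions*, CUP 2014, §2.4 Prop 2.47,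
§8.4 (p-biased derivatives `D_i`, Prop 8.45), Ex. 2.42; G. Grimmett, *Percolation* (1999) Thm 2.4 (Harris–FKG).
-/

noncomputable section

namespace Summit.CriticalPhenomena.PercolationContinuityZ3.Theorems.Crossing.Spectral

open Finset Function MeasureTheory intervalIntegral
open Literature.Probability.ODonnellSaksSchrammServedio2005

variable {ι : Type*} [Fintype ι] [DecidableEq ι]

/-! ## §1 The mixed spectral formula; coefficients of the discrete derivative -/

section Characters

variable {p : ι → ℝ} {r : ι → Bool → ℝ}
  (hH1 : ∀ i, p i * r i true + (1 - p i) * r i false = 0)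
  (hH2 : ∀ i (b b' : Bool), coordWt p i b ≠ 0 → coordWt p i b' * (1 + r i b * r i b') = if b' = b then 1 else 0)

include hH1 hH2 in
/-- **THE MIXED SPECTRAL FORMULA**: `E[f(ω)·g(ω^ε)] = Σ_S (1−ε)^{|S|}·f̂(S)·ĝ(S)` (Plancherel with the diagonal noise operator, gen 20's
`noise_coeff`), every `p ∈ [0,1]^ι`, every character system, every real `ε`.
[cite: ODonnell2014, §2.4 Prop 2.47 and §8.4 (⟨f, T_ρ g⟩ = Σ_S ρ^{|S|} f̂(S)ĝ(S))] [cite: GarbanSteif2014, Ch. IV (1.3)–(1.4)] -/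
theorem noise_cross_correlation_eq_sum_coeff (f g : (ι → Bool) → ℝ) (ε : ℝ) :
    ∑ x : ι → Bool, ∑ y : ι → Bool, ∑ m : ι → Bool, wt p x * wt p y * wt (fun _ => ε) m
        * (f x * g (fun i => if m i = true then y i else x i))
      = ∑ S ∈ (Finset.univ : Finset ι).powerset, (1 - ε) ^ S.card
          * ((∑ x : ι → Bool, wt p x * (f x * ∏ i ∈ S, r i (x i)))
            * (∑ x : ι → Bool, wt p x * (g x * ∏ i ∈ S, r i (x i)))) := by
  calc ∑ x : ι → Bool, ∑ y : ι → Bool, ∑ m : ι → Bool, wt p x * wt p y * wt (fun _ => ε) m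
          * (f x * g (fun i => if m i = true then y i else x i))
      = ∑ x : ι → Bool, wt p x * (f x * ∑ y : ι → Bool, ∑ m : ι → Bool, wt p y * wt (fun _ => ε) m
          * g (fun i => if m i = true then y i else x i)) := by
        refine Finset.sum_congr rfl fun x _ => ?_
        simp only [Finset.mul_sum]
        exact Finset.sum_congr rfl fun y _ => Finset.sum_congr rfl fun m _ => by ring
    _ = ∑ S ∈ (Finset.univ : Finset ι).powerset, (∑ x : ι → Bool, wt p x * (f x * ∏ i ∈ S, r i (x i)))
          * ∑ x : ι → Bool, wt p x * ((∑ y : ι → Bool, ∑ m : ι → Bool, wt p y * wt (fun _ => ε) m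
              * g (fun i => if m i = true then y i else x i)) * ∏ i ∈ S, r i (x i)) :=
        sum_wt_mul_mul_eq_sum_coeff hH2 f _
    _ = ∑ S ∈ (Finset.univ : Finset ι).powerset, (1 - ε) ^ S.card
          * ((∑ x : ι → Bool, wt p x * (f x * ∏ i ∈ S, r i (x i)))
            * (∑ x : ι → Bool, wt p x * (g x * ∏ i ∈ S, r i (x i)))) := by
        refine Finset.sum_congr rfl fun S _ => ?_
        rw [noise_coeff hH1 g ε S]
        ring

include hH1 in
/-- **COEFFICIENTS ABOVE A COORDINATE ARE COEFFICIENTS OF THE DERIVATIVE**: for `i ∉ S`,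
`f̂(S ∪ {i}) = (p_i·r_i(1))·Σ_x wt(x)·D_i f(x)·χ_S(x)` with `D_i f(x) = f(x^{i→1}) − f(x^{i→0})` (integrate out `x_i`: by (H1)
`(1−p_i) r_i(0) = −p_i r_i(1)`). [cite: ODonnell2014, §8.4 Def 8.44 / Prop 8.45 (D_i f = Σ_{S∋i} f̂(S) φ_{S∖i}/σ... the p-biased derivative)] -/
theorem coeff_insert_eq_bias_mul (f : (ι → Bool) → ℝ) {S : Finset ι} {i : ι} (hi : i ∉ S) :
    ∑ x : ι → Bool, wt p x * (f x * ∏ j ∈ insert i S, r j (x j))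
      = (p i * r i true) * ∑ x : ι → Bool, wt p x * ((f (update x i true) - f (update x i false)) * ∏ j ∈ S, r j (x j)) := by
  have hχ : ∀ (x : ι → Bool) (c : Bool), (∏ j ∈ S, r j (update x i c j)) = ∏ j ∈ S, r j (x j) := by
    intro x c
    exact Finset.prod_congr rfl fun j hj => by rw [update_of_ne (ne_of_mem_of_not_mem hj hi)]
  -- branch on `x_i`
  have hsplit : ∀ x : ι → Bool, wt p x * (f x * ∏ j ∈ insert i S, r j (x j))
      = wt p x * (if x i = true then r i true * (f (update x i true) * ∏ j ∈ S, r j (x j))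
          else r i false * (f (update x i false) * ∏ j ∈ S, r j (x j))) := by
    intro x
    rw [Finset.prod_insert hi]
    rcases Bool.eq_false_or_eq_true (x i) with hx | hx
    · rw [if_pos hx]
      have : f x = f (update x i true) := by rw [← hx, update_eq_self]
      rw [← this, hx]; ring
    · rw [if_neg (by simp [hx])]
      have : f x = f (update x i false) := by rw [← hx, update_eq_self]
      rw [← this, hx]; ring
  rw [Finset.sum_congr rfl (fun x _ => hsplit x),
    sum_wt_ite p i _ _ (fun x c => by simp only [update_idem, hχ]) (fun x c => by simp only [update_idem, hχ])]
  have hpull : ∀ (c : ℝ) (b : Bool), ∑ x : ι → Bool, wt p x * (c * (f (update x i b) * ∏ j ∈ S, r j (x j)))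
      = c * ∑ x : ι → Bool, wt p x * (f (update x i b) * ∏ j ∈ S, r j (x j)) := by
    intro c b; rw [Finset.mul_sum]; exact Finset.sum_congr rfl fun x _ => by ring
  rw [hpull, hpull]
  have hsub : ∑ x : ι → Bool, wt p x * ((f (update x i true) - f (update x i false)) * ∏ j ∈ S, r j (x j))
      = ∑ x : ι → Bool, wt p x * (f (update x i true) * ∏ j ∈ S, r j (x j))
        - ∑ x : ι → Bool, wt p x * (f (update x i false) * ∏ j ∈ S, r j (x j)) := by
    rw [← Finset.sum_sub_distrib]; exact Finset.sum_congr rfl fun x _ => by ring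
  rw [hsub]
  have h1 : (1 - p i) * r i false = -(p i * r i true) := by linarith [hH1 i]
  linear_combination (∑ x : ι → Bool, wt p x * (f (update x i false) * ∏ j ∈ S, r j (x j))) * h1

include hH1 in
/-- The derivative `D_i f` does not read `x_i`, so its coefficients vanish on sets containing `i`: `(D_i f)^(S) = 0` for `i ∈ S`
(the factor `E[r_i] = 0`, (H1)). [cite: ODonnell2014, §8.3 Prop 8.23 (E_i kills φ_S for S ∋ i)] -/
theorem coeff_deriv_eq_zero_of_mem (f : (ι → Bool) → ℝ) {S : Finset ι} {i : ι} (hi : i ∈ S) :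
    ∑ x : ι → Bool, wt p x * ((f (update x i true) - f (update x i false)) * ∏ j ∈ S, r j (x j)) = 0 := by
  have hsplit : ∀ x : ι → Bool, wt p x * ((f (update x i true) - f (update x i false)) * ∏ j ∈ S, r j (x j))
      = wt p x * (r i (x i) * ((f (update x i true) - f (update x i false)) * ∏ j ∈ S.erase i, r j (x j))) := by
    intro x
    rw [← Finset.mul_prod_erase S (fun j => r j (x j)) hi]; ring
  rw [Finset.sum_congr rfl (fun x _ => hsplit x), sum_wt_mul_coord p i (fun b => r i b)
    (fun x => (f (update x i true) - f (update x i false)) * ∏ j ∈ S.erase i, r j (x j)) ?_]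
  · rw [hH1 i, zero_mul]
  · intro x c
    simp only [update_idem]
    congr 1
    exact Finset.prod_congr rfl fun j hj => by rw [update_of_ne (Finset.ne_of_mem_erase hj)]

omit [Fintype ι] [DecidableEq ι] in
include hH2 in
/-- `(p_i·r_i(1))² = p_i(1−p_i)` for every character system (H2) — also at a degenerate coordinate, where both sides vanish.
[cite: ODonnell2014, §8.4 Def 8.40 (φ(1) = √((1−p)/p), so p·φ(1) = σ)] -/
theorem sq_bias_mul_char_eq (i : ι) : (p i * r i true) ^ 2 = p i * (1 - p i) := by
  by_cases hp : p i = 0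
  · rw [hp]; ring
  · have h := hH2 i true true (by simpa [coordWt] using hp)
    simp only [coordWt, if_true] at h
    nlinarith [h]


include hH1 hH2 in
/-- **THE JOINT-PIVOTAL SPECTRAL FORMULA** (one coordinate): for every real `ε`,
`p_i(1−p_i)·E[D_i f(ω)·D_i g(ω^ε)] = Σ_{S ∋ i} (1−ε)^{|S|−1}·f̂(S)·ĝ(S)` — the mixed spectral formula for the pair `(D_i f, D_i g)`, whose
coefficients are `f̂(S ∪ {i})/(p_i r_i(1))` off `i` and `0` on sets containing `i`.
[cite: ODonnell2014, §8.4 Prop 8.45 (D_i and the coefficients f̂(S ∪ i)); §2.4 Prop 2.47] [cite: Talagrand1996, §2 (⟨Δ_i f, T Δ_i g⟩)] -/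
theorem bias_mul_deriv_noise_eq_sum_coeff (f g : (ι → Bool) → ℝ) (ε : ℝ) (i : ι) :
    p i * (1 - p i) * ∑ x : ι → Bool, ∑ y : ι → Bool, ∑ m : ι → Bool, wt p x * wt p y * wt (fun _ => ε) m
        * ((f (update x i true) - f (update x i false))
          * (g (update (fun j => if m j = true then y j else x j) i true)
            - g (update (fun j => if m j = true then y j else x j) i false)))
      = ∑ S ∈ (Finset.univ : Finset ι).powerset.filter (fun S => i ∈ S), (1 - ε) ^ (S.card - 1)
          * ((∑ x : ι → Bool, wt p x * (f x * ∏ j ∈ S, r j (x j)))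
            * (∑ x : ι → Bool, wt p x * (g x * ∏ j ∈ S, r j (x j)))) := by
  -- the mixed spectral formula for the pair of derivatives
  have hmix := noise_cross_correlation_eq_sum_coeff hH1 hH2 (fun x => f (update x i true) - f (update x i false))
    (fun x => g (update x i true) - g (update x i false)) ε
  rw [hmix, Finset.mul_sum]
  -- coefficient bookkeeping
  have hterm : ∀ S ∈ (Finset.univ : Finset ι).powerset, p i * (1 - p i) * ((1 - ε) ^ S.card
      * ((∑ x : ι → Bool, wt p x * ((f (update x i true) - f (update x i false)) * ∏ j ∈ S, r j (x j)))
        * (∑ x : ι → Bool, wt p x * ((g (update x i true) - g (update x i false)) * ∏ j ∈ S, r j (x j)))))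
      = if i ∉ S then (1 - ε) ^ S.card
          * ((∑ x : ι → Bool, wt p x * (f x * ∏ j ∈ insert i S, r j (x j)))
            * (∑ x : ι → Bool, wt p x * (g x * ∏ j ∈ insert i S, r j (x j)))) else 0 := by
    intro S _
    split_ifs with hiS
    · rw [coeff_deriv_eq_zero_of_mem hH1 f hiS]; ring
    · rw [coeff_insert_eq_bias_mul hH1 f hiS, coeff_insert_eq_bias_mul hH1 g hiS]
      have hsq := sq_bias_mul_char_eq hH2 i
      rw [← hsq]; ring
  rw [Finset.sum_congr rfl hterm, ← Finset.sum_filter]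
  -- reindex `S ↦ S ∪ {i}`
  refine Finset.sum_nbij' (fun S => insert i S) (fun T => T.erase i) ?_ ?_ ?_ ?_ ?_
  · intro S hS
    simp only [Finset.mem_filter, Finset.mem_powerset, Finset.subset_univ, true_and, Finset.mem_insert_self]
  · intro T hT
    simp only [Finset.mem_filter, Finset.mem_powerset, Finset.subset_univ, true_and] at hT ⊢
    exact Finset.notMem_erase i T
  · intro S hS
    simp only [Finset.mem_filter, Finset.mem_powerset] at hS
    exact Finset.erase_insert hS.2
  · intro T hT
    simp only [Finset.mem_filter, Finset.mem_powerset] at hT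
    exact Finset.insert_erase hT.2
  · intro S hS
    simp only [Finset.mem_filter, Finset.mem_powerset] at hS
    rw [Finset.card_insert_of_notMem hS.2, Nat.add_sub_cancel]

include hH1 hH2 in
/-- **THE JOINT-PIVOTAL SPECTRAL FORMULA, summed**: `Σ_i p_i(1−p_i)·E[D_i f(ω)·D_i g(ω^ε)] = Σ_S |S|·(1−ε)^{|S|−1}·f̂(S)·ĝ(S)` — minus the
`ε`-derivative of the mixed noise correlation `Σ_S (1−ε)^{|S|} f̂(S)ĝ(S)`.
[cite: Talagrand1996, §2 (d/dt ⟨f, T_t g⟩ = Σ_i ⟨Δ_i f, T_t Δ_i g⟩)] [cite: ODonnell2014, §2.4 Prop 2.47, §8.4 Prop 8.45] -/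
theorem sum_bias_mul_deriv_noise_eq (f g : (ι → Bool) → ℝ) (ε : ℝ) :
    ∑ i, p i * (1 - p i) * ∑ x : ι → Bool, ∑ y : ι → Bool, ∑ m : ι → Bool, wt p x * wt p y * wt (fun _ => ε) m
        * ((f (update x i true) - f (update x i false))
          * (g (update (fun j => if m j = true then y j else x j) i true)
            - g (update (fun j => if m j = true then y j else x j) i false)))
      = ∑ S ∈ (Finset.univ : Finset ι).powerset, (S.card : ℝ) * ((1 - ε) ^ (S.card - 1)
          * ((∑ x : ι → Bool, wt p x * (f x * ∏ j ∈ S, r j (x j)))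
            * (∑ x : ι → Bool, wt p x * (g x * ∏ j ∈ S, r j (x j))))) := by
  obtain ⟨c, hc⟩ : ∃ c : Finset ι → ℝ, c = fun S => (1 - ε) ^ (S.card - 1)
      * ((∑ x : ι → Bool, wt p x * (f x * ∏ j ∈ S, r j (x j)))
        * (∑ x : ι → Bool, wt p x * (g x * ∏ j ∈ S, r j (x j)))) := ⟨_, rfl⟩
  have hi : ∀ i, p i * (1 - p i) * ∑ x : ι → Bool, ∑ y : ι → Bool, ∑ m : ι → Bool, wt p x * wt p y * wt (fun _ => ε) m
        * ((f (update x i true) - f (update x i false))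
          * (g (update (fun j => if m j = true then y j else x j) i true)
            - g (update (fun j => if m j = true then y j else x j) i false)))
      = ∑ S ∈ (Finset.univ : Finset ι).powerset, (if i ∈ S then c S else 0) := by
    intro i
    rw [bias_mul_deriv_noise_eq_sum_coeff hH1 hH2 f g ε i, Finset.sum_filter, hc]
  rw [Finset.sum_congr rfl (fun i _ => hi i), Finset.sum_comm]
  refine Finset.sum_congr rfl fun S _ => ?_
  rw [Finset.sum_ite_mem, Finset.univ_inter, Finset.sum_const, nsmul_eq_mul, hc]

end Characters

/-! ## §2 The Harris slack as a noise integral (no characters in the statements) -/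

section Integral

variable (p : ι → ℝ) (h0 : ∀ i, 0 ≤ p i) (h1 : ∀ i, p i ≤ 1)

omit [Fintype ι] [DecidableEq ι] in
/-- Calculus: `ε ↦ −Σ_S (1−ε)^{|S|}·c_S` has derivative `Σ_S |S|(1−ε)^{|S|−1}·c_S`. [folklore] -/
theorem hasDerivAt_neg_sum_pow (U : Finset (Finset ι)) (c : Finset ι → ℝ) (ε : ℝ) :
    HasDerivAt (fun ε' => -∑ S ∈ U, (1 - ε') ^ S.card * c S)
      (∑ S ∈ U, (S.card : ℝ) * ((1 - ε) ^ (S.card - 1) * c S)) ε := by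
  have hlin : HasDerivAt (fun ε' : ℝ => 1 - ε') (-1) ε := by
    simpa using (hasDerivAt_id ε).const_sub (1 : ℝ)
  have hS : ∀ S ∈ U, HasDerivAt (fun ε' : ℝ => -((1 - ε') ^ S.card * c S))
      ((S.card : ℝ) * ((1 - ε) ^ (S.card - 1) * c S)) ε := by
    intro S _
    have h := ((hlin.pow S.card).mul_const (c S)).neg
    refine h.congr_deriv ?_
    ring
  have hsum := HasDerivAt.sum hS
  refine hsum.congr_of_eventuallyEq (Filter.Eventually.of_forall fun ε' => ?_)
  simp only [Finset.sum_apply, Finset.sum_neg_distrib]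

include h0 h1 in
/-- **THE HARRIS SLACK AS A NOISE INTEGRAL** (every `p ∈ [0,1]^ι`, all real `f, g`, all real `a, b`):
`E[f(ω)·g(ω^a)] − E[f(ω)·g(ω^b)] = ∫_a^b Σ_i p_i(1−p_i)·E[D_i f(ω)·D_i g(ω^ε)] dε` — the mixed noise correlation decreases, per unit of noise,
by the `p(1−p)`-weighted joint pivotality of the two functions (`ω^ε = (y on {m = 1}, x elsewhere)`, `y ~ wt p`, `m ~ wt ε̄`;
`D_i h(z) = h(z^{i→1}) − h(z^{i→0})`).  No characters: the p-biased spectral formulas of §1 are used inside the proof.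
[cite: Talagrand1996, §2 (Cov(f,g) = ∫ Σ_i ⟨Δ_i f, T_t Δ_i g⟩ dt)] [cite: KellerMosselSen2014, §3 (the semigroup interpolation for product measures)] -/
theorem noise_cross_correlation_sub_eq_integral (f g : (ι → Bool) → ℝ) (a b : ℝ) :
    (∑ x : ι → Bool, ∑ y : ι → Bool, ∑ m : ι → Bool, wt p x * wt p y * wt (fun _ => a) m
        * (f x * g (fun i => if m i = true then y i else x i)))
      - (∑ x : ι → Bool, ∑ y : ι → Bool, ∑ m : ι → Bool, wt p x * wt p y * wt (fun _ => b) m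
        * (f x * g (fun i => if m i = true then y i else x i)))
      = ∫ ε in a..b, ∑ i, p i * (1 - p i) * ∑ x : ι → Bool, ∑ y : ι → Bool, ∑ m : ι → Bool,
          wt p x * wt p y * wt (fun _ => ε) m
            * ((f (update x i true) - f (update x i false))
              * (g (update (fun j => if m j = true then y j else x j) i true)
                - g (update (fun j => if m j = true then y j else x j) i false))) := by
  -- p-biased characters and the product coefficients `c_S = f̂(S) ĝ(S)`
  have hH1 := pbiased_H1 p
  have hH2 := pbiased_H2 p h0 h1
  obtain ⟨c, hc⟩ : ∃ c : Finset ι → ℝ, c = fun S =>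
      (∑ x : ι → Bool, wt p x * (f x * ∏ j ∈ S, (((if x j then (1 : ℝ) else 0) - p j) / Real.sqrt (p j * (1 - p j)))))
        * (∑ x : ι → Bool, wt p x * (g x * ∏ j ∈ S, (((if x j then (1 : ℝ) else 0) - p j) / Real.sqrt (p j * (1 - p j))))) :=
    ⟨_, rfl⟩
  have hN : ∀ ε : ℝ, ∑ x : ι → Bool, ∑ y : ι → Bool, ∑ m : ι → Bool, wt p x * wt p y * wt (fun _ => ε) m
        * (f x * g (fun i => if m i = true then y i else x i))
      = ∑ S ∈ (Finset.univ : Finset ι).powerset, (1 - ε) ^ S.card * c S := by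
    intro ε; rw [noise_cross_correlation_eq_sum_coeff hH1 hH2 f g ε, hc]
  have hΦ : ∀ ε : ℝ, ∑ i, p i * (1 - p i) * ∑ x : ι → Bool, ∑ y : ι → Bool, ∑ m : ι → Bool,
        wt p x * wt p y * wt (fun _ => ε) m
          * ((f (update x i true) - f (update x i false))
            * (g (update (fun j => if m j = true then y j else x j) i true)
              - g (update (fun j => if m j = true then y j else x j) i false)))
      = ∑ S ∈ (Finset.univ : Finset ι).powerset, (S.card : ℝ) * ((1 - ε) ^ (S.card - 1) * c S) := by
    intro ε; rw [sum_bias_mul_deriv_noise_eq hH1 hH2 f g ε, hc]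
  rw [intervalIntegral.integral_congr (fun ε _ => hΦ ε), hN a, hN b,
    intervalIntegral.integral_eq_sub_of_hasDerivAt (fun ε _ => hasDerivAt_neg_sum_pow (Finset.univ.powerset) c ε)
      ((continuous_finsetSum _ fun S _ => by fun_prop).intervalIntegrable a b)]
  ring

/-- At noise level `0` the noised copy is the configuration itself: `E[f(ω)·g(ω^0)] = E[f·g]`. [folklore] -/
theorem noise_zero_eq (f g : (ι → Bool) → ℝ) :
    ∑ x : ι → Bool, ∑ y : ι → Bool, ∑ m : ι → Bool, wt p x * wt p y * wt (fun _ => (0 : ℝ)) m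
        * (f x * g (fun i => if m i = true then y i else x i))
      = ∑ x : ι → Bool, wt p x * (f x * g x) := by
  classical
  have hm : ∀ x y : ι → Bool, ∑ m : ι → Bool, wt p x * wt p y * wt (fun _ => (0 : ℝ)) m
      * (f x * g (fun i => if m i = true then y i else x i)) = wt p x * wt p y * (f x * g x) := by
    intro x y
    rw [Finset.sum_eq_single (fun _ => false)]
    · simp [wt, coordWt]
    · intro m _ hm
      obtain ⟨i, hi0⟩ := Function.ne_iff.1 hm
      have hi : m i = true := by simpa using hi0
      have : wt (fun _ => (0 : ℝ)) m = 0 := by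
        unfold wt
        exact Finset.prod_eq_zero (Finset.mem_univ i) (by simp [coordWt, hi])
      rw [this]; ring
    · intro h; exact absurd (Finset.mem_univ _) h
  rw [Finset.sum_congr rfl fun x _ => Finset.sum_congr rfl fun y _ => hm x y]
  exact sum_sum_wt_mul_left p (fun x => f x * g x)

/-- At noise level `1` the noised copy is an independent configuration: `E[f(ω)·g(ω^1)] = E[f]·E[g]`. [folklore] -/
theorem noise_one_eq (f g : (ι → Bool) → ℝ) :
    ∑ x : ι → Bool, ∑ y : ι → Bool, ∑ m : ι → Bool, wt p x * wt p y * wt (fun _ => (1 : ℝ)) m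
        * (f x * g (fun i => if m i = true then y i else x i))
      = (∑ x : ι → Bool, wt p x * f x) * (∑ x : ι → Bool, wt p x * g x) := by
  classical
  have hm : ∀ x y : ι → Bool, ∑ m : ι → Bool, wt p x * wt p y * wt (fun _ => (1 : ℝ)) m
      * (f x * g (fun i => if m i = true then y i else x i)) = wt p x * wt p y * (f x * g y) := by
    intro x y
    rw [Finset.sum_eq_single (fun _ => true)]
    · simp [wt, coordWt]
    · intro m _ hm
      obtain ⟨i, hi0⟩ := Function.ne_iff.1 hm
      have hi : m i = false := by simpa using hi0
      have : wt (fun _ => (1 : ℝ)) m = 0 := by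
        unfold wt
        exact Finset.prod_eq_zero (Finset.mem_univ i) (by simp [coordWt, hi])
      rw [this]; ring
    · intro h; exact absurd (Finset.mem_univ _) h
  rw [Finset.sum_congr rfl fun x _ => Finset.sum_congr rfl fun y _ => hm x y, Finset.sum_mul_sum]
  exact Finset.sum_congr rfl fun x _ => Finset.sum_congr rfl fun y _ => by ring

include h0 h1 in
/-- **THE COVARIANCE IS THE NOISE-AVERAGED JOINT PIVOTALITY** (every `p ∈ [0,1]^ι`, all real `f, g`):
`E[f·g] − E[f]·E[g] = ∫_0^1 Σ_i p_i(1−p_i)·E[D_i f(ω)·D_i g(ω^ε)] dε`.  For monotone events `f = 𝟙_A`, `g = 𝟙_B`: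
`P(A ∩ B) − P(A)P(B) = ∫_0^1 Σ_i p_i(1−p_i)·P(i pivotal for A in ω and for B in ω^ε) dε` — an exact formula for the Harris slack.
[cite: Talagrand1996, §2] [cite: KellerMosselSen2014, §3] [cite: ODonnell2014, §8.4 Prop 8.45] -/
theorem cov_eq_integral (f g : (ι → Bool) → ℝ) :
    ∑ x : ι → Bool, wt p x * (f x * g x) - (∑ x : ι → Bool, wt p x * f x) * (∑ x : ι → Bool, wt p x * g x)
      = ∫ ε in (0 : ℝ)..1, ∑ i, p i * (1 - p i) * ∑ x : ι → Bool, ∑ y : ι → Bool, ∑ m : ι → Bool,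
          wt p x * wt p y * wt (fun _ => ε) m
            * ((f (update x i true) - f (update x i false))
              * (g (update (fun j => if m j = true then y j else x j) i true)
                - g (update (fun j => if m j = true then y j else x j) i false))) := by
  rw [← noise_cross_correlation_sub_eq_integral p h0 h1 f g 0 1, noise_zero_eq p f g, noise_one_eq p f g]

end Integral

end Summit.CriticalPhenomena.PercolationContinuityZ3.Theorems.Crossing.Spectral

end
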